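import Summits.BirchSwinnertonDyer.BirchSwinnertonDyer.Theorems.ShaPrimaryTransferFiniteShaComponentTransferSelmerCubicCoverReal
import Literature.NumberTheory.EllipticCurves.ShaVanishingFromSelmerBound
import HarnessLib

/-!
# BirchSwinnertonDyer — the SEL2CUBIC door, assembled: kernel general `2`-descent data ⟹ `t₂(E) = 0`,
# `Ш(E/ℚ)[2^∞] = 0`, `rank E(ℚ) = r` (totally real cubic `2`-division field, PID ring of integers)

HONEST FRAMING: route `ShaPrimaryTransfer`, seat `bsd-line-spt-p1` (g29), `--supports` item T =
`FiniteShaComponentTransfer` (stmt-22356), which is UNCHANGED (conjecture-grade at corank ≥ 2). BSD in rank ≥ 2 is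
NOT proved by any of this. THEOREMS ONLY.

One theorem turns the PRIMITIVE data of a cell-`b2b-bsdr2` kernel `2`-descent certificate
(`Rank2Observatory<label>TwoDescRankTwo`: curve `y² = x³ + Ax² + Bx + C` with irreducible cubic, root `θ ∈ 𝓞_K`
of the cubic in its `2`-division field `K` (totally real, `h_K = 1`), generators `G` of the primes above `F′(θ)`,
fundamental units `Wu`, their norms and sign bits at the three real places, an admissibility test implied by the
three-real-place sieve `admStd3R`, and the kernel-counted number of admissible pairs `≤ 2^r`) together with a
LOWER bound `rank E(ℚ) ≥ r` into the unconditional conclusions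

  `t₂(E) = corank_{ℤ₂} Ш(E/ℚ)[2^∞] = 0`, `Ш(E/ℚ)[2^∞] = 0`, `rank E(ℚ) = r`

(`shaCorank_two_eq_zero_of_admStd3R`; residue form `shaCorank_two_eq_zero_of_admStd3RQ` for the kernel-decidable
test `admStd3RQ` the certificates count with). Assembly of: the Selmer cover `natCard_selmerGroup_le_of_coverSet`
(`…SelmerCubicCover`), the Selmer-soundness of the sieve `admStd3R_sound_sel` (`…SelmerCubicCoverReal`), and the
closing step of the descent `WeierstrassCurve.shaCorank_eq_zero_of_natCard_selmerGroup_le` (Literature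
`ShaVanishingFromSelmerBound`: `#Sel⁽²⁾ ≤ 2^r ≤ 2^{rank}` forces `Ш[2] = 0`). The per-curve residue is the
certificate's own side data (see `…SelmerCubic389a1Sha` for `389a1`).
[cite: Cassels1991LecturesEllipticCurves, §15] [cite: SilvermanAEC2009, Thm. X.4.2, Rem. X.4.1]
[cite: CremonaAlgorithms1997, §3.6]
-/

-- single-conjunct summit: `Summit.BirchSwinnertonDyer.BirchSwinnertonDyer.…` repeats the name by design
set_option linter.dupNamespace false

noncomputable section

open scoped Classical NumberField

open Literature.NumberTheory.NumberFields Literature.NumberTheory.EllipticCurves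
  Polynomial Module NumberField IsDedekindDomain
open WeierstrassCurve WeierstrassCurve.Affine

namespace Summit.BirchSwinnertonDyer.BirchSwinnertonDyer.Theorems.ShaPrimaryTransferSelmerCubicCover

open Summit.BirchSwinnertonDyer.BirchSwinnertonDyer.Rank2Observatory
open Summit.BirchSwinnertonDyer.BirchSwinnertonDyer.Rank2Observatory.TwoDescCubic

variable {K : Type} [Field K] [NumberField K] {A B C : ℤ} {θ : 𝓞 K}

/-- **The SEL2CUBIC door.** Let `E : y² = x³ + Ax² + Bx + C` over `ℚ` have irreducible `2`-division cubic with
root `θ ∈ 𝓞_K`, `[K : ℚ] = 3`, `𝓞_K` a PID, three real embeddings ordered by `ρ₁(θ) < ρ₂(θ) < ρ₃(θ)`; let `G`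
enumerate (injectively, by primes) the primes above `F′(θ) = 3θ² + 2Aθ + B`, `Wu` generate `𝓞_Kˣ/𝓞_Kˣ²`, with
norms `Nu, Ng` and sign bits `su_k, sg_k` at `ρ_k`; let `adm` be any test implied by the three-real-place sieve
`admStd3R`. If the number of admissible pairs is `≤ 2^r` and `rank E(ℚ) ≥ r`, then
`t₂(E) = 0`, `Ш(E/ℚ)[2^∞] = 0` and `rank E(ℚ) = r` — unconditionally (complete `2`-descent:
`#Sel⁽²⁾(E/ℚ) ≤ #adm ≤ 2^r ≤ 2^{rank}`). [cite: Cassels1991LecturesEllipticCurves, §15]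
[cite: SilvermanAEC2009, Thm. X.4.2, Rem. X.4.1] -/
theorem shaCorank_two_eq_zero_of_admStd3R [IsPrincipalIdealRing (𝓞 K)] (E : WeierstrassCurve ℚ) [E.IsElliptic]
    (ha₁ : E.a₁ = 0) (ha₂ : E.a₂ = A) (ha₃ : E.a₃ = 0) (ha₄ : E.a₄ = B) (ha₆ : E.a₆ = C)
    (hirr : Irreducible (MonicCubic.polyQ A B C))
    (hθ : aeval (algebraMap (𝓞 K) K θ) (MonicCubic.poly A B C) = 0) (h3 : finrank ℚ K = 3)
    [(E.baseChange K).IsElliptic] (ρ₁ ρ₂ ρ₃ : K →+* ℝ)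
    (h12 : ρ₁ (algebraMap (𝓞 K) K θ) < ρ₂ (algebraMap (𝓞 K) K θ))
    (h23 : ρ₂ (algebraMap (𝓞 K) K θ) < ρ₃ (algebraMap (𝓞 K) K θ))
    {s : ℕ} {G : Fin s → 𝓞 K} (hG : Function.Injective G) (hGp : ∀ j, Prime (G j))
    (hD : ∀ q : 𝓞 K, Prime q → q ∣ 3 * θ ^ 2 + 2 * A * θ + B → ∃ j, Associated q (G j))
    {m : ℕ} {Wu : Fin m → (𝓞 K)ˣ} (hW : ∀ u : (𝓞 K)ˣ, ∃ T : Finset (Fin m), IsSquare (u * ∏ i ∈ T, Wu i))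
    {Nu : Fin m → ℤ} (hNu : ∀ i, Algebra.norm ℚ (algebraMap (𝓞 K) K (Wu i)) = Nu i)
    {Ng : Fin s → ℤ} (hNg : ∀ j, Algebra.norm ℚ (algebraMap (𝓞 K) K (G j)) = Ng j)
    {su₁ su₂ su₃ : Fin m → Bool} {sg₁ sg₂ sg₃ : Fin s → Bool}
    (hsu₁ : ∀ i, su₁ i = true ↔ ρ₁ (algebraMap (𝓞 K) K (Wu i)) < 0)
    (hsu₂ : ∀ i, su₂ i = true ↔ ρ₂ (algebraMap (𝓞 K) K (Wu i)) < 0)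
    (hsu₃ : ∀ i, su₃ i = true ↔ ρ₃ (algebraMap (𝓞 K) K (Wu i)) < 0)
    (hsg₁ : ∀ j, sg₁ j = true ↔ ρ₁ (algebraMap (𝓞 K) K (G j)) < 0)
    (hsg₂ : ∀ j, sg₂ j = true ↔ ρ₂ (algebraMap (𝓞 K) K (G j)) < 0)
    (hsg₃ : ∀ j, sg₃ j = true ↔ ρ₃ (algebraMap (𝓞 K) K (G j)) < 0)
    {adm : Finset (Fin m) → Finset (Fin s) → Bool}
    (hadm : ∀ T U, admStd3R Nu Ng su₁ su₂ su₃ sg₁ sg₂ sg₃ T U = true → adm T U = true)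
    {r : ℕ} (hcount : ((Finset.univ ×ˢ Finset.univ).filter
      (fun p : Finset (Fin m) × Finset (Fin s) => adm p.1 p.2 = true)).card ≤ 2 ^ r)
    (hrank : r ≤ E.mordellWeilRank) :
    E.shaCorank 2 = 0 ∧ AddCommGroup.primaryComponent E.sha 2 = ⊥ ∧ E.mordellWeilRank = r := by
  have hw0 : ∀ i, algebraMap (𝓞 K) K (Wu i) ≠ 0 := fun i =>
    (RingOfIntegers.coe_ne_zero_iff).mpr (Units.ne_zero _)
  have hg0 : ∀ j, algebraMap (𝓞 K) K (G j) ≠ 0 := fun j =>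
    (RingOfIntegers.coe_ne_zero_iff).mpr (hGp j).ne_zero
  have hle : Nat.card (selmerGroup E 2) ≤ 2 ^ r :=
    (natCard_selmerGroup_le_of_coverSet E ha₁ ha₂ ha₃ ha₄ ha₆ hirr hθ h3 hG (fun j => (hGp j).ne_zero) hD hW
      (adm := adm) (fun c hc a ha T U hsq => hadm T U
        (admStd3R_sound_sel E ha₁ ha₂ ha₃ ha₄ ha₆ hirr hθ h3 ρ₁ ρ₂ ρ₃ h12 h23 hw0 hg0 hNu hNg
          hsu₁ hsu₂ hsu₃ hsg₁ hsg₂ hsg₃ hc a ha T U hsq))).trans hcount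
  exact E.shaCorank_eq_zero_of_natCard_selmerGroup_le 2 hle hrank

/-- **The SEL2CUBIC door, residue form** — the same with the kernel-decidable residue test `admStd3RQ Q`
(square residues modulo the list `Q` of positive moduli) the certificates count with.
[cite: Cassels1991LecturesEllipticCurves, §15] [cite: SilvermanAEC2009, Thm. X.4.2, Rem. X.4.1] -/
theorem shaCorank_two_eq_zero_of_admStd3RQ [IsPrincipalIdealRing (𝓞 K)] (E : WeierstrassCurve ℚ) [E.IsElliptic]
    (ha₁ : E.a₁ = 0) (ha₂ : E.a₂ = A) (ha₃ : E.a₃ = 0) (ha₄ : E.a₄ = B) (ha₆ : E.a₆ = C)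
    (hirr : Irreducible (MonicCubic.polyQ A B C))
    (hθ : aeval (algebraMap (𝓞 K) K θ) (MonicCubic.poly A B C) = 0) (h3 : finrank ℚ K = 3)
    [(E.baseChange K).IsElliptic] (ρ₁ ρ₂ ρ₃ : K →+* ℝ)
    (h12 : ρ₁ (algebraMap (𝓞 K) K θ) < ρ₂ (algebraMap (𝓞 K) K θ))
    (h23 : ρ₂ (algebraMap (𝓞 K) K θ) < ρ₃ (algebraMap (𝓞 K) K θ))
    {s : ℕ} {G : Fin s → 𝓞 K} (hG : Function.Injective G) (hGp : ∀ j, Prime (G j))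
    (hD : ∀ q : 𝓞 K, Prime q → q ∣ 3 * θ ^ 2 + 2 * A * θ + B → ∃ j, Associated q (G j))
    {m : ℕ} {Wu : Fin m → (𝓞 K)ˣ} (hW : ∀ u : (𝓞 K)ˣ, ∃ T : Finset (Fin m), IsSquare (u * ∏ i ∈ T, Wu i))
    {Nu : Fin m → ℤ} (hNu : ∀ i, Algebra.norm ℚ (algebraMap (𝓞 K) K (Wu i)) = Nu i)
    {Ng : Fin s → ℤ} (hNg : ∀ j, Algebra.norm ℚ (algebraMap (𝓞 K) K (G j)) = Ng j)
    {su₁ su₂ su₃ : Fin m → Bool} {sg₁ sg₂ sg₃ : Fin s → Bool}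
    (hsu₁ : ∀ i, su₁ i = true ↔ ρ₁ (algebraMap (𝓞 K) K (Wu i)) < 0)
    (hsu₂ : ∀ i, su₂ i = true ↔ ρ₂ (algebraMap (𝓞 K) K (Wu i)) < 0)
    (hsu₃ : ∀ i, su₃ i = true ↔ ρ₃ (algebraMap (𝓞 K) K (Wu i)) < 0)
    (hsg₁ : ∀ j, sg₁ j = true ↔ ρ₁ (algebraMap (𝓞 K) K (G j)) < 0)
    (hsg₂ : ∀ j, sg₂ j = true ↔ ρ₂ (algebraMap (𝓞 K) K (G j)) < 0)
    (hsg₃ : ∀ j, sg₃ j = true ↔ ρ₃ (algebraMap (𝓞 K) K (G j)) < 0)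
    (Q : List ℕ) (hQ : ∀ q ∈ Q, 0 < q)
    {r : ℕ} (hcount : ((Finset.univ ×ˢ Finset.univ).filter (fun p : Finset (Fin m) × Finset (Fin s) =>
      admStd3RQ Q Nu Ng su₁ su₂ su₃ sg₁ sg₂ sg₃ p.1 p.2 = true)).card ≤ 2 ^ r)
    (hrank : r ≤ E.mordellWeilRank) :
    E.shaCorank 2 = 0 ∧ AddCommGroup.primaryComponent E.sha 2 = ⊥ ∧ E.mordellWeilRank = r :=
  shaCorank_two_eq_zero_of_admStd3R E ha₁ ha₂ ha₃ ha₄ ha₆ hirr hθ h3 ρ₁ ρ₂ ρ₃ h12 h23 hG hGp hD hW hNu hNg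
    hsu₁ hsu₂ hsu₃ hsg₁ hsg₂ hsg₃ (adm := admStd3RQ Q Nu Ng su₁ su₂ su₃ sg₁ sg₂ sg₃)
    (fun _ _ h => admStd3RQ_of_admStd3R hQ h) hcount hrank

end Summit.BirchSwinnertonDyer.BirchSwinnertonDyer.Theorems.ShaPrimaryTransferSelmerCubicCover

end
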